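import Literature.Analysis.Complex.CauchyTransform
import Mathlib.Analysis.Distribution.AEEqOfIntegralContDiff
import Mathlib.Analysis.Calculus.ParametricIntegral
import Mathlib.Analysis.Calculus.BumpFunction.InnerProduct
import Mathlib.MeasureTheory.Measure.OpenPos
import HarnessLib

/-!
# Weyl's lemma for `∂/∂z̄`: weakly holomorphic `L¹` functions are holomorphic

**Theorem (Weyl's lemma for the Cauchy–Riemann operator).** (i) Local form `weyl_dbar_ball`: if
`f` is integrable on `B̄(z₀, 3R)` and `∫ f · ∂̄φ dA = 0` for every smooth `φ : ℂ → ℂ` compactly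
supported in `B̄(z₀, 3R)` (`∂̄ = ½(∂ₓ + i∂_y)` = the tree's `dbarAlong 1`), then `f = g` a.e. on
`B(z₀, R)` for some `g` holomorphic on `B(z₀, 3R/2)`. (ii) Open sets `weyl_dbar`: a function locally
integrable on an open `U ⊆ ℂ` with vanishing distributional `∂̄` agrees a.e. on `U` with ONE
holomorphic function (H. Weyl 1940 for `Δ`; Hörmander, *ALPDO I*, Thm. 4.4.1). [folklore]

Proof of (i) by the Cauchy transform, without mollifier limits: for a cut-off `χ` (`= 1` on
`B̄(z₀, 2R)`, supported in `B̄(z₀, 3R)`) and a test function `φ` supported in `B(z₀, R)`, the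
Cauchy transform `ψ = K ⋆ φ` (`K(t) = 1/(πt)`) is smooth with `∂̄ψ = φ` (Hörmander, Thm. 1.2.2,
in the tree: `dbarAlong_one_cauchyTransform`), `χψ` is admissible and `∂̄(χψ) = φ + ψ ∂̄χ`, so
`∫ f φ = -∫ f ∂̄χ ψ = ∫ φ g` with `g(w) = -∫ f ∂̄χ (π(z - w))⁻¹ dA(z)` (Fubini; the kernel is
evaluated only at `|z - w| ≥ R` since `f ∂̄χ` lives in `2R ≤ |z - z₀| ≤ 3R`); `g` is holomorphic on
`B(z₀, 3R/2)` (differentiation under the integral sign) and `f = g` a.e. by the fundamental lemma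
of the calculus of variations (`IsOpen.ae_eq_zero_of_integral_contDiff_smul_eq_zero`). (ii):
the local representatives agree on overlaps (`Measure.eqOn_open_of_ae_eq`) and patch; the a.e.
statement uses a countable subcover. References: Hörmander, *SCV* (1973), Thm. 1.2.2;
*ALPDO I*, Thm. 4.4.1; H. Weyl, Duke Math. J. 7 (1940).
-/

noncomputable section

open MeasureTheory Set Filter Function Complex Metric TopologicalSpace
open scoped Real Topology ContDiff

namespace Literature.Analysis.Complex

/-- **Leibniz rule for `∂/∂z̄`**: `∂̄(ab) = (∂̄a) b + a (∂̄b)`. [folklore] -/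
theorem dbarAlong_one_mul {a b : ℂ → ℂ} {z : ℂ} (ha : DifferentiableAt ℝ a z)
    (hb : DifferentiableAt ℝ b z) :
    dbarAlong 1 (fun w => a w * b w) z = dbarAlong 1 a z * b z + a z * dbarAlong 1 b z := by
  rw [dbarAlong_one, dbarAlong_one, dbarAlong_one, fderiv_fun_mul ha hb]
  simp only [_root_.add_apply, FunLike.coe_smul, Pi.smul_apply, smul_eq_mul]
  ring

/-- `∂̄` of a function vanishes off its topological support. [folklore] -/
theorem dbarAlong_eq_zero_of_notMem_tsupport {u : ℂ → ℂ} {z : ℂ} (hz : z ∉ tsupport u) :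
    dbarAlong 1 u z = 0 := by
  have h : fderiv ℝ u z = 0 := by
    by_contra hne
    exact hz (support_fderiv_subset ℝ (mem_support.2 hne))
  simp [dbarAlong_one, h]

/-- `∂̄` of a function vanishes where the function is locally constant. [folklore] -/
theorem dbarAlong_eq_zero_of_eventuallyEq_const {u : ℂ → ℂ} {z : ℂ} {c : ℂ}
    (h : u =ᶠ[𝓝 z] fun _ => c) : dbarAlong 1 u z = 0 := by
  have : fderiv ℝ u z = 0 := by rw [h.fderiv_eq]; simp
  simp [dbarAlong_one, this]

/-- **Holomorphy of the Cauchy transform off the support.** If `F` is integrable and vanishes on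
`B(c, ρ₁)`, then for `ρ₂ < ρ₁` the function `w ↦ ∫ F(z) (π (z - w))⁻¹ dA(z)` is holomorphic on
`B(c, ρ₂)` (differentiate under the integral sign: the `w`-derivative `π⁻¹ (z - w)⁻²` of the kernel
is bounded by `π⁻¹ (ρ₁ - ρ₂)⁻²` on `supp F × B(c, ρ₂)`; Hörmander 1973, Thm. 1.2.2). [folklore] -/
theorem differentiableOn_integral_mul_cauchyKernel {F : ℂ → ℂ} (hF : Integrable F)
    {c : ℂ} {ρ₁ ρ₂ : ℝ} (hρ : ρ₂ < ρ₁) (hzero : ∀ z ∈ ball c ρ₁, F z = 0) :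
    DifferentiableOn ℂ (fun w => ∫ z, F z * (↑π * (z - w))⁻¹) (ball c ρ₂) := by
  intro w₀ hw₀
  set d : ℝ := ρ₁ - ρ₂ with hd
  have hd0 : 0 < d := by rw [hd]; linarith
  -- distance from `supp F` to the small ball
  have hfar : ∀ z, F z ≠ 0 → ∀ w ∈ ball c ρ₂, d ≤ ‖z - w‖ := by
    intro z hz w hw
    have hz' : ρ₁ ≤ dist z c := by
      by_contra h; exact hz (hzero z (mem_ball.2 (lt_of_not_ge h)))
    rw [mem_ball] at hw
    have := dist_triangle z w c
    simp only [dist_eq_norm] at this hw hz'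
    linarith
  set G : ℂ → ℂ → ℂ := fun w z => F z * (↑π * (z - w))⁻¹ with hG
  set G' : ℂ → ℂ → ℂ := fun w z => F z * ((↑π)⁻¹ * ((z - w) ^ 2)⁻¹) with hG'
  have hmeasK : ∀ w, AEStronglyMeasurable (G w) volume := fun w =>
    hF.aestronglyMeasurable.mul
      ((continuous_const.mul (continuous_id.sub continuous_const)).measurable.inv.aestronglyMeasurable)
  have hbound_ker : ∀ z, F z ≠ 0 → ∀ w ∈ ball c ρ₂, ‖(↑π * (z - w))⁻¹‖ ≤ π⁻¹ * d⁻¹ := by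
    intro z hz w hw
    have hzw := hfar z hz w hw
    have hzw0 : 0 < ‖z - w‖ := hd0.trans_le hzw
    rw [norm_inv, norm_mul, Complex.norm_real, Real.norm_eq_abs, abs_of_pos Real.pi_pos,
      mul_inv]
    exact mul_le_mul_of_nonneg_left (inv_anti₀ hd0 hzw) (by positivity)
  have hint : ∀ w ∈ ball c ρ₂, Integrable (G w) := by
    intro w hw
    refine Integrable.mono' (hF.norm.mul_const (π⁻¹ * d⁻¹)) (hmeasK w) (Eventually.of_forall ?_)
    intro z
    simp only [hG, norm_mul]
    by_cases hz : F z = 0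
    · simp [hz]
    · exact mul_le_mul_of_nonneg_left (hbound_ker z hz w hw) (norm_nonneg _)
  have hmeas' : AEStronglyMeasurable (G' w₀) volume := by
    refine hF.aestronglyMeasurable.mul (Measurable.aestronglyMeasurable ?_)
    exact measurable_const.mul ((measurable_id.sub measurable_const).pow_const 2).inv
  have hbound : ∀ᵐ z ∂volume, ∀ w ∈ ball c ρ₂, ‖G' w z‖ ≤ ‖F z‖ * (π⁻¹ * (d ^ 2)⁻¹) := by
    refine Eventually.of_forall fun z w hw => ?_
    simp only [hG', norm_mul, norm_inv, norm_pow, Complex.norm_real, Real.norm_eq_abs,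
      abs_of_pos Real.pi_pos]
    by_cases hz : F z = 0
    · simp [hz]
    · have hzw := hfar z hz w hw
      refine mul_le_mul_of_nonneg_left ?_ (norm_nonneg _)
      refine mul_le_mul_of_nonneg_left ?_ (by positivity)
      exact inv_anti₀ (pow_pos hd0 2) (pow_le_pow_left₀ hd0.le hzw 2)
  have hdiff : ∀ᵐ z ∂volume, ∀ w ∈ ball c ρ₂, HasDerivAt (G · z) (G' w z) w := by
    refine Eventually.of_forall fun z w hw => ?_
    by_cases hz : F z = 0
    · simp only [hG, hG', hz, zero_mul]; exact hasDerivAt_const w 0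
    · have hzw : z - w ≠ 0 := by
        have := hfar z hz w hw; intro h0; rw [h0, norm_zero] at this; linarith
      have hπ : (π : ℂ) ≠ 0 := ofReal_ne_zero.2 Real.pi_pos.ne'
      have h1 : HasDerivAt (fun w : ℂ => ↑π * (z - w)) (↑π * (0 - 1)) w :=
        ((hasDerivAt_const w z).sub (hasDerivAt_id w)).const_mul _
      have h2 : HasDerivAt (G · z) (F z * (-(↑π * (0 - 1)) / (↑π * (z - w)) ^ 2)) w :=
        (h1.inv (mul_ne_zero hπ hzw)).const_mul (F z)
      refine h2.congr_deriv ?_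
      simp only [hG']
      field_simp
      ring
  have key := hasDerivAt_integral_of_dominated_loc_of_deriv_le (isOpen_ball.mem_nhds hw₀)
    (Eventually.of_forall hmeasK) (hint w₀ hw₀) hmeas' hbound (hF.norm.mul_const _) hdiff
  exact key.2.differentiableAt.differentiableWithinAt

/-- Coercion of a real test function to `ℂ` preserves smoothness. [folklore] -/
theorem contDiff_ofReal_comp {γ : ℂ → ℝ} {n : WithTop ℕ∞} (hγ : ContDiff ℝ n γ) :
    ContDiff ℝ n fun z => ((γ z : ℝ) : ℂ) :=
  ofRealCLM.contDiff.comp hγ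

/-- The topological support of `z ↦ (γ z : ℂ)` is that of `γ`. [folklore] -/
theorem tsupport_ofReal_comp_subset (γ : ℂ → ℝ) :
    tsupport (fun z => ((γ z : ℝ) : ℂ)) ⊆ tsupport γ :=
  closure_mono (support_comp_subset ofReal_zero γ)

/-- **Weyl's lemma for `∂/∂z̄` (local form).** If `f` is integrable on `B̄(z₀, 3R)` with
`∫ f · ∂̄φ = 0` for every smooth `φ : ℂ → ℂ` compactly supported in `B̄(z₀, 3R)`, then `f = g` a.e.
on `B(z₀, R)` for some `g` holomorphic on `B(z₀, 3R/2)` (`g(w) = -∫ f ∂̄χ (π(z - w))⁻¹ dA`, see the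
module docstring; H. Weyl 1940, Hörmander *ALPDO I* Thm. 4.4.1). [folklore] -/
theorem weyl_dbar_ball {f : ℂ → ℂ} {z₀ : ℂ} {R : ℝ} (hR : 0 < R)
    (hf : IntegrableOn f (closedBall z₀ (3 * R)))
    (h : ∀ φ : ℂ → ℂ, ContDiff ℝ ∞ φ → HasCompactSupport φ →
      tsupport φ ⊆ closedBall z₀ (3 * R) → ∫ z, f z * dbarAlong 1 φ z = 0) :
    ∃ g : ℂ → ℂ, DifferentiableOn ℂ g (ball z₀ (3 * R / 2)) ∧
      ∀ᵐ z ∂volume, z ∈ ball z₀ R → f z = g z := by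
  let χ : ContDiffBump z₀ := ⟨2 * R, 3 * R, by linarith, by linarith⟩
  set χc : ℂ → ℂ := fun z => ((χ z : ℝ) : ℂ) with hχc
  have hχc_smooth : ContDiff ℝ ∞ χc := contDiff_ofReal_comp χ.contDiff
  have hχc_diff : ∀ z, DifferentiableAt ℝ χc z := fun z =>
    (hχc_smooth.differentiable (by simp)).differentiableAt
  have hχc_one : ∀ z ∈ closedBall z₀ (2 * R), χc z = 1 := fun z hz => by
    simp [hχc, χ.one_of_mem_closedBall (show z ∈ closedBall z₀ χ.rIn from hz)]
  have hχc_supp : tsupport χc ⊆ closedBall z₀ (3 * R) := by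
    refine (tsupport_ofReal_comp_subset χ).trans ?_
    rw [χ.tsupport_eq]
  have hχc_cpt : HasCompactSupport χc := χ.hasCompactSupport.comp_left ofReal_zero
  set dχ : ℂ → ℂ := dbarAlong 1 χc with hdχ
  have hdχ_cont : Continuous dχ := by
    have hc : Continuous (fderiv ℝ χc) := hχc_smooth.continuous_fderiv (by simp)
    have : dχ = fun z => (2 : ℂ)⁻¹ • (fderiv ℝ χc z 1 + I • fderiv ℝ χc z I) := by
      ext z; rw [hdχ, dbarAlong_one]
    rw [this]
    exact ((hc.clm_apply continuous_const).add
      ((hc.clm_apply continuous_const).const_smul I)).const_smul ((2 : ℂ)⁻¹)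
  have hdχ_zero_in : ∀ z ∈ ball z₀ (2 * R), dχ z = 0 := fun z hz =>
    dbarAlong_eq_zero_of_eventuallyEq_const (c := 1) (by
      filter_upwards [isOpen_ball.mem_nhds hz] with w hw
      exact hχc_one w (ball_subset_closedBall hw))
  have hdχ_zero_out : ∀ z, z ∉ closedBall z₀ (3 * R) → dχ z = 0 := fun z hz =>
    dbarAlong_eq_zero_of_notMem_tsupport fun h' => hz (hχc_supp h')
  have hdχ_cpt : HasCompactSupport dχ := HasCompactSupport.intro (isCompact_closedBall _ _) hdχ_zero_out
  obtain ⟨B, hB⟩ := hdχ_cont.bounded_above_of_compact_support hdχ_cpt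
  set f₀ : ℂ → ℂ := (closedBall z₀ (3 * R)).indicator f with hf₀
  have hf₀_int : Integrable f₀ := hf.integrable_indicator measurableSet_closedBall
  have hf₀_eq : ∀ z ∈ closedBall z₀ (3 * R), f₀ z = f z := fun z hz => by simp [hf₀, hz]
  have hf₀_zero : ∀ z, z ∉ closedBall z₀ (3 * R) → f₀ z = 0 := fun z hz => by simp [hf₀, hz]
  set F : ℂ → ℂ := fun z => f₀ z * dχ z with hF
  have hF_int : Integrable F :=
    hf₀_int.mul_bdd hdχ_cont.aestronglyMeasurable (Eventually.of_forall hB)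
  have hF_zero_in : ∀ z ∈ ball z₀ (2 * R), F z = 0 := fun z hz => by
    simp [hF, hdχ_zero_in z hz]
  have hF_zero_out : ∀ z, z ∉ closedBall z₀ (3 * R) → F z = 0 := fun z hz => by
    simp [hF, hdχ_zero_out z hz]
  set g : ℂ → ℂ := fun w => -∫ z, F z * (↑π * (z - w))⁻¹ with hg
  have hg_hol : DifferentiableOn ℂ g (ball z₀ (3 * R / 2)) :=
    (differentiableOn_integral_mul_cauchyKernel hF_int (by linarith : 3 * R / 2 < 2 * R)
      hF_zero_in).neg
  refine ⟨g, hg_hol, ?_⟩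
  have hident : ∀ φ : ℂ → ℂ, ContDiff ℝ ∞ φ → HasCompactSupport φ → tsupport φ ⊆ ball z₀ R →
      ∫ z, φ z * f₀ z = ∫ z, φ z * g z := by
    intro φ hφ hφc hφs
    have hφ1 : ContDiff ℝ 1 φ := hφ.of_le (by exact_mod_cast le_top)
    have hφ_cont : Continuous φ := hφ.continuous
    have hφ_int : Integrable φ := hφ_cont.integrable_of_hasCompactSupport hφc
    obtain ⟨Bφ, hBφ⟩ := hφ_cont.bounded_above_of_compact_support hφc
    -- the Cauchy transform `ψ` of `φ`: smooth, `∂̄ψ = φ`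
    set ψ : ℂ → ℂ := fun z : ℂ => ∫ t : ℂ, (↑π * t)⁻¹ • φ (z - t) with hψ
    have hψ_smooth : ContDiff ℝ ∞ ψ := contDiff_cauchyTransform hφ hφc
    have hψ_diff : ∀ z, DifferentiableAt ℝ ψ z := fun z =>
      (hψ_smooth.differentiable (by simp)).differentiableAt
    have hψ_dbar : ∀ z, dbarAlong 1 ψ z = φ z := fun z => dbarAlong_one_cauchyTransform hφ1 hφc z
    -- the admissible test function `Φ = χ ψ`
    set Φ : ℂ → ℂ := fun z => χc z * ψ z with hΦ
    have hΦ_smooth : ContDiff ℝ ∞ Φ := hχc_smooth.mul hψ_smooth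
    have hΦ_cpt : HasCompactSupport Φ := hχc_cpt.mul_right
    have hΦ_supp : tsupport Φ ⊆ closedBall z₀ (3 * R) :=
      (tsupport_mul_subset_left (f := χc) (g := ψ)).trans hχc_supp
    have hΦ_dbar : ∀ z, dbarAlong 1 Φ z = dχ z * ψ z + χc z * φ z := fun z => by
      rw [show dbarAlong 1 Φ z = dbarAlong 1 (fun w => χc w * ψ w) z from rfl,
        dbarAlong_one_mul (hχc_diff z) (hψ_diff z), hψ_dbar]
    have hχφ : ∀ z, χc z * φ z = φ z := fun z => by
      by_cases hz : z ∈ tsupport φ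
      · rw [hχc_one z (closedBall_subset_closedBall (by linarith)
          (ball_subset_closedBall (hφs hz))), one_mul]
      · rw [image_eq_zero_of_notMem_tsupport hz, mul_zero]
    -- the hypothesis on `Φ`, rewritten pointwise
    have h0 := h Φ hΦ_smooth hΦ_cpt hΦ_supp
    have hptw : ∀ z, f z * dbarAlong 1 Φ z = F z * ψ z + φ z * f₀ z := by
      intro z
      by_cases hz : z ∈ closedBall z₀ (3 * R)
      · rw [hΦ_dbar, hχφ, hF, ← hf₀_eq z hz]; ring
      · rw [dbarAlong_eq_zero_of_notMem_tsupport fun h' => hz (hΦ_supp h'), hf₀_zero z hz,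
          hF_zero_out z hz]; ring
    simp_rw [hptw] at h0
    -- integrability of the two pieces
    have hFψ_int : Integrable fun z => F z * ψ z := by
      have hsupp : support (fun z => F z * ψ z) ⊆ closedBall z₀ (3 * R) := by
        intro z hz
        by_contra hz'
        exact hz (by simp [hF_zero_out z hz'])
      rw [← integrableOn_iff_integrable_of_support_subset hsupp]
      exact (hF_int.integrableOn.mul_continuousOn hψ_smooth.continuous.continuousOn
        (isCompact_closedBall _ _))
    have hφf₀_int : Integrable fun z => φ z * f₀ z :=
      hf₀_int.bdd_mul hφ_cont.aestronglyMeasurable (Eventually.of_forall hBφ)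
    rw [integral_add hFψ_int hφf₀_int] at h0
    -- Fubini: `∫ F ψ = ∫ φ(w) (∫ F(z) K(z - w) dz) dw`
    have hψw : ∀ z, ψ z = ∫ w, (↑π * (z - w))⁻¹ * φ w := fun z => by
      rw [hψ]
      simp only [smul_eq_mul]
      rw [← integral_sub_left_eq_self (fun w => (↑π * (z - w))⁻¹ * φ w) volume z]
      congr 1
      ext t
      simp
    set H : ℂ → ℂ → ℂ := fun z w => F z * (↑π * (z - w))⁻¹ * φ w with hH
    have hH_meas : AEStronglyMeasurable (uncurry H) (volume.prod volume) := by
      refine ((hF_int.aestronglyMeasurable.comp_fst).mul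
        (Measurable.aestronglyMeasurable ?_)).mul (hφ_cont.aestronglyMeasurable.comp_snd)
      exact (measurable_const.mul (measurable_fst.sub measurable_snd)).inv
    have hH_int : Integrable (uncurry H) (volume.prod volume) := by
      refine Integrable.mono' (hF_int.norm.mul_prod (hφ_int.norm.const_mul (π⁻¹ * R⁻¹)))
        hH_meas (Eventually.of_forall ?_)
      rintro ⟨z, w⟩
      simp only [uncurry, hH, norm_mul]
      by_cases hz : F z = 0
      · simp [hz]
      by_cases hw : φ w = 0
      · simp [hw]
      have hzfar : 2 * R ≤ dist z z₀ := by
        by_contra h'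
        exact hz (hF_zero_in z (mem_ball.2 (lt_of_not_ge h')))
      have hwin : dist w z₀ < R := mem_ball.1 (hφs (subset_tsupport _ (mem_support.2 hw)))
      have hzw : R ≤ ‖z - w‖ := by
        have := dist_triangle z w z₀
        simp only [dist_eq_norm] at this hzfar hwin
        linarith
      have hker : ‖(↑π * (z - w))⁻¹‖ ≤ π⁻¹ * R⁻¹ := by
        rw [norm_inv, norm_mul, Complex.norm_real, Real.norm_eq_abs, abs_of_pos Real.pi_pos,
          mul_inv]
        exact mul_le_mul_of_nonneg_left (inv_anti₀ hR hzw) (by positivity)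
      calc ‖F z‖ * ‖(↑π * (z - w))⁻¹‖ * ‖φ w‖ ≤ ‖F z‖ * (π⁻¹ * R⁻¹) * ‖φ w‖ := by gcongr
        _ = ‖F z‖ * (π⁻¹ * R⁻¹ * ‖φ w‖) := by ring
    have hfub : ∫ z, F z * ψ z = ∫ w, φ w * ∫ z, F z * (↑π * (z - w))⁻¹ := by
      calc ∫ z, F z * ψ z = ∫ z, ∫ w, H z w := by
            congr 1; ext z
            rw [hψw, ← integral_const_mul]
            congr 1; ext w
            simp only [hH]; ring
        _ = ∫ w, ∫ z, H z w := integral_integral_swap hH_int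
        _ = ∫ w, φ w * ∫ z, F z * (↑π * (z - w))⁻¹ := by
            congr 1; ext w
            rw [← integral_const_mul]
            congr 1; ext z
            simp only [hH]; ring
    -- conclusion of the identity
    have hgw : ∫ z, φ z * g z = -∫ w, φ w * ∫ z, F z * (↑π * (z - w))⁻¹ := by
      rw [← integral_neg]
      congr 1; ext w
      simp only [hg]; ring
    rw [hfub] at h0
    rw [hgw]
    linear_combination h0
  have hV : IsOpen (ball z₀ R) := isOpen_ball
  have hsub : ball z₀ R ⊆ ball z₀ (3 * R / 2) := ball_subset_ball (by linarith)
  have hg_cont : ContinuousOn g (ball z₀ R) := (hg_hol.mono hsub).continuousOn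
  have hloc : LocallyIntegrableOn (fun z => f₀ z - g z) (ball z₀ R) :=
    (hf₀_int.locallyIntegrable.locallyIntegrableOn _).sub
      (hg_cont.locallyIntegrableOn hV.measurableSet)
  have hae := hV.ae_eq_zero_of_integral_contDiff_smul_eq_zero hloc fun γ hγ hγc hγs => by
    have hγ' : ContDiff ℝ ∞ (fun z => ((γ z : ℝ) : ℂ)) := contDiff_ofReal_comp hγ
    have hγc' : HasCompactSupport (fun z => ((γ z : ℝ) : ℂ)) := hγc.comp_left ofReal_zero
    have hγs' : tsupport (fun z => ((γ z : ℝ) : ℂ)) ⊆ ball z₀ R :=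
      (tsupport_ofReal_comp_subset γ).trans hγs
    have hid := hident _ hγ' hγc' hγs'
    obtain ⟨Bγ, hBγ⟩ := hγ.continuous.bounded_above_of_compact_support hγc
    have hi1 : Integrable fun z => ((γ z : ℝ) : ℂ) * f₀ z :=
      hf₀_int.bdd_mul hγ'.continuous.aestronglyMeasurable
        (Eventually.of_forall fun z => by simpa using hBγ z)
    have hi2 : Integrable fun z => ((γ z : ℝ) : ℂ) * g z := by
      refine Continuous.integrable_of_hasCompactSupport ?_ hγc'.mul_right
      refine continuous_iff_continuousAt.2 fun z => ?_
      by_cases hz : z ∈ ball z₀ R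
      · exact (hγ'.continuous.continuousAt).mul (hg_cont.continuousAt (hV.mem_nhds hz))
      · have hz' : z ∉ tsupport (fun z => ((γ z : ℝ) : ℂ)) := fun h' => hz (hγs' h')
        have hev : (fun z => ((γ z : ℝ) : ℂ) * g z) =ᶠ[𝓝 z] fun _ => 0 := by
          have : (fun z => ((γ z : ℝ) : ℂ)) =ᶠ[𝓝 z] 0 := by
            rwa [← notMem_tsupport_iff_eventuallyEq] 
          filter_upwards [this] with w hw
          simp [hw]
        exact (continuousAt_const.congr hev.symm)
    simp only [Complex.real_smul, mul_sub]
    rw [integral_sub hi1 hi2, hid, sub_self]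
  filter_upwards [hae] with z hz hzR
  have h1 := sub_eq_zero.1 (hz hzR)
  rw [← h1, hf₀_eq z (closedBall_subset_closedBall (by linarith) (ball_subset_closedBall hzR))]

/-- **Weyl's lemma for `∂/∂z̄` (open sets).** If `U ⊆ ℂ` is open and `f` is locally integrable on
`U` with `∫ f · ∂̄φ dA = 0` for all smooth `φ : ℂ → ℂ` compactly supported in `U`, then `f = g` a.e.
on `U` for some `g` holomorphic on `U` (H. Weyl 1940; Hörmander, *ALPDO I*, Thm. 4.4.1). [folklore] -/
theorem weyl_dbar {U : Set ℂ} (hU : IsOpen U) {f : ℂ → ℂ} (hf : LocallyIntegrableOn f U)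
    (h : ∀ φ : ℂ → ℂ, ContDiff ℝ ∞ φ → HasCompactSupport φ → tsupport φ ⊆ U →
      ∫ z, f z * dbarAlong 1 φ z = 0) :
    ∃ g : ℂ → ℂ, DifferentiableOn ℂ g U ∧ ∀ᵐ z ∂volume, z ∈ U → f z = g z := by
  classical
  have hloc : ∀ x : U, ∃ R : ℝ, 0 < R ∧ closedBall (x : ℂ) (3 * R) ⊆ U ∧
      ∃ g : ℂ → ℂ, DifferentiableOn ℂ g (ball (x : ℂ) (3 * R / 2)) ∧
        ∀ᵐ z ∂volume, z ∈ ball (x : ℂ) R → f z = g z := by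
    rintro ⟨x, hx⟩
    obtain ⟨ε, hε, hεU⟩ := Metric.isOpen_iff.1 hU x hx
    have hsub : closedBall x (3 * (ε / 4)) ⊆ U := (closedBall_subset_ball (by linarith)).trans hεU
    refine ⟨ε / 4, by positivity, hsub, ?_⟩
    refine weyl_dbar_ball (by positivity) (hf.integrableOn_compact_subset hsub
      (isCompact_closedBall _ _)) fun φ hφ hφc hφs => h φ hφ hφc (hφs.trans hsub)
  choose R hR hRU gl hgl hae using hloc
  have hagree : ∀ x y : U, ∀ z ∈ ball (x : ℂ) (R x) ∩ ball (y : ℂ) (R y), gl x z = gl y z := by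
    intro x y z hz
    have hV : IsOpen (ball (x : ℂ) (R x) ∩ ball (y : ℂ) (R y)) := isOpen_ball.inter isOpen_ball
    have hcx : ContinuousOn (gl x) (ball (x : ℂ) (R x) ∩ ball (y : ℂ) (R y)) :=
      ((hgl x).mono ((inter_subset_left).trans (ball_subset_ball (by linarith [hR x])))).continuousOn
    have hcy : ContinuousOn (gl y) (ball (x : ℂ) (R x) ∩ ball (y : ℂ) (R y)) :=
      ((hgl y).mono ((inter_subset_right).trans (ball_subset_ball (by linarith [hR y])))).continuousOn
    have haexy : gl x =ᵐ[volume.restrict (ball (x : ℂ) (R x) ∩ ball (y : ℂ) (R y))] gl y := by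
      rw [EventuallyEq, ae_restrict_iff' hV.measurableSet]
      filter_upwards [hae x, hae y] with w hwx hwy hw
      rw [← hwx hw.1, ← hwy hw.2]
    exact Measure.eqOn_open_of_ae_eq haexy hV hcx hcy hz
  set g : ℂ → ℂ := fun z => if hz : z ∈ U then gl ⟨z, hz⟩ z else 0 with hg
  have hg_loc : ∀ x : U, ∀ z ∈ ball (x : ℂ) (R x), g z = gl x z := by
    intro x z hz
    have hzU : z ∈ U := hRU x ((ball_subset_closedBall.trans
      (closedBall_subset_closedBall (by linarith [hR x]))) hz)
    simp only [hg, dif_pos hzU]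
    exact hagree ⟨z, hzU⟩ x z ⟨mem_ball_self (hR _), hz⟩
  refine ⟨g, ?_, ?_⟩
  · intro z hz
    have hball : ball z (R ⟨z, hz⟩) ∈ 𝓝 z := ball_mem_nhds z (hR _)
    have hev : g =ᶠ[𝓝 z] gl ⟨z, hz⟩ := by
      filter_upwards [hball] with w hw
      exact hg_loc ⟨z, hz⟩ w hw
    have hd : DifferentiableAt ℂ (gl ⟨z, hz⟩) z :=
      (hgl ⟨z, hz⟩).differentiableAt (ball_mem_nhds z (by linarith [hR ⟨z, hz⟩]))
    exact (hd.congr_of_eventuallyEq hev).differentiableWithinAt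
  · -- countable subcover of `U` by the balls `ball x (R x)`
    obtain ⟨t, htU, htc, hcover⟩ := countable_cover_nhdsWithin
      (f := fun x : ℂ => if hx : x ∈ U then ball x (R ⟨x, hx⟩) else ∅) (s := U) (by
        intro x hx
        simp only [dif_pos hx]
        exact mem_nhdsWithin_of_mem_nhds (ball_mem_nhds x (hR _)))
    have hall : ∀ᵐ z ∂volume, ∀ x ∈ t, ∀ hx : x ∈ U, z ∈ ball x (R ⟨x, hx⟩) → f z = g z := by
      rw [ae_ball_iff htc]
      intro x hxt
      have hxU : x ∈ U := htU hxt
      filter_upwards [hae ⟨x, hxU⟩] with z hz hx' hzb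
      rw [hz hzb, hg_loc ⟨x, hxU⟩ z hzb]
    filter_upwards [hall] with z hz hzU
    obtain ⟨x, hxt, hzx⟩ : ∃ x ∈ t, z ∈ (if hx : x ∈ U then ball x (R ⟨x, hx⟩) else ∅) := by
      simpa only [mem_iUnion, exists_prop] using hcover hzU
    have hxU : x ∈ U := htU hxt
    rw [dif_pos hxU] at hzx
    exact hz x hxt hxU hzx

end Literature.Analysis.Complex

end
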